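import Mathlib
import Summits.KontsevichZagierPeriods.Zeta5Search.RecordRayCell1112
import HarnessLib

/-!
# ζ(5) search — the record ray's cell `10n < p ≤ 11n`: every class has `E_x ≥ −6`, `casLB ≥ −9` (sharp), `N_p = 17`, and the PATH node there

Cell `pub-zeta5` (HONEST FRAMING: systematic search; no irrationality claim unless certified), TRACK «DENOM-LAW» D1 prover seat
(denom-prover-d1 g11, `HOME/denom-law/prover-d1/ATTEMPT-11.md` §8).  On Brown–Zudilin's record ray `b(n) = n·(41;17,…,11)` and `10n < p ≤ 11n` a class
has three, four or five points (`x + 3p ≤ 41n` iff `x ≤ 41n − 3p`, `x + 4p ≤ 41n` iff `x ≤ 41n − 4p < n`; `x + 5p > 41n`); the depth bookkeeping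
gives `E_x ≥ −6` for EVERY class (sharp: four points with `x + p ∈ [17n, 21n)`), hence `casLB(b(n),p) ≥ −9` (`VB ≥ −6`, rows `≥ −3`; the census
value) and, by THEOREM LB, `v_p(Cas_j(b(n))) ≥ −9`.  Here `⌊d/p⌋ = 2`, `N_p = 17`, `C⋆ ≤ 11`, so the PATH ACCOUNTING node's value is
`2 − 17 − min(1, 5 − C⋆) ≤ −9`: `PathAccountingFirstPeriod`'s literal conclusion holds on this cell (`pathAccounting_bRec_cell1011`).
Integer bookkeeping; nothing about irrationality.
-/

open Finset

namespace Summit.KontsevichZagierPeriods.Zeta5Search.RecordRay1011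

open Summit.KontsevichZagierPeriods.Zeta5Search.ClusterValuation
open Summit.KontsevichZagierPeriods.Zeta5Search.CasoratianValuation (InPolytope pairFloors refund shift casoratian)
open Summit.KontsevichZagierPeriods.Zeta5Search.WedgeDictionary (dOf)
open Summit.KontsevichZagierPeriods.Zeta5Search.CellA
open Summit.KontsevichZagierPeriods.Zeta5Search.RecordRayTop (self_mem_class add_mem_class)
open Summit.KontsevichZagierPeriods.Zeta5Search.RecordRayMid14 (dep7_le_low dep7_le_high netExp_ge mem2 classExp_ge_sub)
open Summit.KontsevichZagierPeriods.Zeta5Search.RecordRay1112 (mem3)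
open Summit.KontsevichZagierPeriods.Zeta5Search.DenomLaw (cStar)
open Summit.KontsevichZagierPeriods.Zeta5Search.DenomLaw.FirstPeriodKit (cStar_le_eleven)

section Cell

/-- The class of `x < p`: its points among `x + kp`, `k ≤ 4`, as soon as `5p > 41n`. -/
theorem mem_class_cases5 {n p x : ℕ} (h5p : 41 * n < 5 * p) (hx : x < p) {s : ℕ} (hs : s ∈ classSet (bRec n) p x) :
    s = x ∨ s = x + p ∨ s = x + 2 * p ∨ (s = x + 3 * p ∧ x + 3 * p ≤ 41 * n) ∨ (s = x + 4 * p ∧ x + 4 * p ≤ 41 * n) := by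
  rw [mem_classSet_iff, bRec_zero_toNat] at hs
  obtain ⟨hs41, k, hk⟩ := hs
  have hk0 : 0 ≤ k := by
    by_contra hneg
    push Not at hneg
    have : (p : ℤ) * k ≤ (p : ℤ) * (-1) := mul_le_mul_of_nonneg_left (by omega) (by omega)
    omega
  have hk5 : k < 5 := by
    by_contra hge
    push Not at hge
    have : (p : ℤ) * 5 ≤ (p : ℤ) * k := mul_le_mul_of_nonneg_left hge (by omega)
    omega
  interval_cases k
  · left; omega
  · right; left; omega
  · right; right; left; omega
  · right; right; right; left; constructor <;> omega
  · right; right; right; right; constructor <;> omega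

variable {n p x : ℕ} (hp10 : 10 * n < p) (hp11 : p ≤ 11 * n) (hx : x < p)

/-- `x + 4p` lies in the class when `≤ 41n`. -/
theorem mem4 (h : x + 4 * p ≤ 41 * n) : x + 4 * p ∈ classSet (bRec n) p x := by
  rw [mem_classSet_iff, bRec_zero_toNat]; exact ⟨h, 4, by push_cast; ring⟩

include hp10 hp11 hx in
/-- **Every class has `E_x ≥ −6`** for `10n < p ≤ 11n`. -/
theorem classExp_ge_neg6 : (-6 : ℤ) ≤ classExp (bRec n) p x := by
  have hv41 : x + p ≤ 41 * n := by omega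
  have hw41 : x + 2 * p ≤ 41 * n := by omega
  have gx := netExp_ge n x
  have gv := netExp_ge n (x + p)
  have gw := netExp_ge n (x + 2 * p)
  have d1le := dep7_le n (x + p)
  have d2le := dep7_le n (x + 2 * p)
  have e0 : dep7 n x = 0 := dep7_low (by omega)
  rw [e0] at gx
  push_cast at gx
  have hsub3 : ({x, x + p, x + 2 * p} : Finset ℕ) ⊆ classSet (bRec n) p x := by
    intro s hs
    simp only [mem_insert, mem_singleton] at hs
    rcases hs with rfl | rfl | rfl
    · exact self_mem_class (by omega) hx
    · exact add_mem_class hv41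
    · exact mem2 hw41
  by_cases hu : x + 3 * p ≤ 41 * n
  · have gu := netExp_ge n (x + 3 * p)
    have e3 : dep7 n (x + 3 * p) = 0 := dep7_high (by omega)
    rw [e3] at gu
    push_cast at gu
    have hsub4 : ({x, x + p, x + 2 * p, x + 3 * p} : Finset ℕ) ⊆ classSet (bRec n) p x := by
      intro s hs
      rw [mem_insert] at hs
      rcases hs with rfl | hs
      · exact self_mem_class (by omega) hx
      exact (show ({x + p, x + 2 * p, x + 3 * p} : Finset ℕ) ⊆ classSet (bRec n) p x from by
        intro t ht
        simp only [mem_insert, mem_singleton] at ht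
        rcases ht with rfl | rfl | rfl
        · exact add_mem_class hv41
        · exact mem2 hw41
        · exact mem3 hu) hs
    by_cases hz : x + 4 * p ≤ 41 * n
    · -- five points: `x < n`, `x + p < 12n` (depth ≤ 1), `x + 2p` any depth, `x + 3p > 30n` and `x + 4p > 40n` zeros
      have gz := netExp_ge n (x + 4 * p)
      have e4 : dep7 n (x + 4 * p) = 0 := dep7_high (by omega)
      rw [e4] at gz
      push_cast at gz
      have hsub5 : ({x, x + p, x + 2 * p, x + 3 * p, x + 4 * p} : Finset ℕ) ⊆ classSet (bRec n) p x := by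
        intro s hs
        rw [mem_insert] at hs
        rcases hs with rfl | hs
        · exact self_mem_class (by omega) hx
        rw [mem_insert] at hs
        rcases hs with rfl | hs
        · exact add_mem_class hv41
        rw [mem_insert] at hs
        rcases hs with rfl | hs
        · exact mem2 hw41
        rw [mem_insert, mem_singleton] at hs
        rcases hs with rfl | rfl
        · exact mem3 hu
        · exact mem4 hz
      have hrest : ∀ s ∈ classSet (bRec n) p x, s ∉ ({x, x + p, x + 2 * p, x + 3 * p, x + 4 * p} : Finset ℕ) →
          0 ≤ netExp (bRec n) s := by
        intro s hs hns
        rcases mem_class_cases5 (by omega) hx hs with rfl | rfl | rfl | ⟨rfl, -⟩ | ⟨rfl, -⟩ <;> simp at hns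
      have hE := classExp_ge_sub ({x, x + p, x + 2 * p, x + 3 * p, x + 4 * p} : Finset ℕ) hsub5 hrest
      rw [sum_insert (by simp; omega), sum_insert (by simp; omega), sum_insert (by simp; omega), sum_pair (by omega)] at hE
      have e1 := dep7_le_low (n := n) (q := x + p) (k := 1) (by norm_num) (by omega)
      have : ((dep7 n (x + p) : ℕ) : ℤ) ≤ 1 := by exact_mod_cast e1
      have : ((dep7 n (x + 2 * p) : ℕ) : ℤ) ≤ 7 := by exact_mod_cast d2le
      linarith
    · -- four points: `d₁ + d₂ ≤ 10`
      have hrest : ∀ s ∈ classSet (bRec n) p x, s ∉ ({x, x + p, x + 2 * p, x + 3 * p} : Finset ℕ) → 0 ≤ netExp (bRec n) s := by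
        intro s hs hns
        rcases mem_class_cases5 (by omega) hx hs with rfl | rfl | rfl | ⟨rfl, -⟩ | ⟨rfl, h4⟩
        · simp at hns
        · simp at hns
        · simp at hns
        · simp at hns
        · omega
      have hE := classExp_ge_sub ({x, x + p, x + 2 * p, x + 3 * p} : Finset ℕ) hsub4 hrest
      rw [sum_insert (by simp; omega), sum_insert (by simp; omega), sum_pair (by omega)] at hE
      have h10 : dep7 n (x + p) + dep7 n (x + 2 * p) ≤ 10 := by
        by_cases h3 : x + p < 13 * n
        · have := dep7_le_low (n := n) (q := x + p) (k := 2) (by norm_num) (by omega)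
          omega
        by_cases h3' : x + p < 14 * n
        · have := dep7_le_low (n := n) (q := x + p) (k := 3) (by norm_num) (by omega)
          omega
        by_cases h4 : x + p < 15 * n
        · have := dep7_le_low (n := n) (q := x + p) (k := 4) (by norm_num) (by omega)
          have := dep7_le_high (n := n) (q := x + 2 * p) (k := 6) (by norm_num) (by omega)
          omega
        by_cases h5 : x + p < 16 * n
        · have := dep7_le_low (n := n) (q := x + p) (k := 5) (by norm_num) (by omega)
          have := dep7_le_high (n := n) (q := x + 2 * p) (k := 5) (by norm_num) (by omega)
          omega
        by_cases h6 : x + p < 17 * n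
        · have := dep7_le_low (n := n) (q := x + p) (k := 6) (by norm_num) (by omega)
          have := dep7_le_high (n := n) (q := x + 2 * p) (k := 4) (by norm_num) (by omega)
          omega
        · have := dep7_le_high (n := n) (q := x + 2 * p) (k := 3) (by norm_num) (by omega)
          omega
      have : ((dep7 n (x + p) : ℕ) : ℤ) + ((dep7 n (x + 2 * p) : ℕ) : ℤ) ≤ 10 := by exact_mod_cast h10
      linarith
  · -- three points: `x + p > 41n − 2p ≥ 19n` has depth ≤ 7 and `x + 2p > 41n − p ≥ 30n` is a zero
    push Not at hu
    have hrest : ∀ s ∈ classSet (bRec n) p x, s ∉ ({x, x + p, x + 2 * p} : Finset ℕ) → 0 ≤ netExp (bRec n) s := by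
      intro s hs hns
      rcases mem_class_cases5 (by omega) hx hs with rfl | rfl | rfl | ⟨rfl, h3⟩ | ⟨rfl, h4⟩
      · simp at hns
      · simp at hns
      · simp at hns
      · omega
      · omega
    have hE := classExp_ge_sub ({x, x + p, x + 2 * p} : Finset ℕ) hsub3 hrest
    rw [sum_insert (by simp; omega), sum_pair (by omega)] at hE
    have e2 : dep7 n (x + 2 * p) = 0 := dep7_high (by omega)
    rw [e2] at gw
    push_cast at gw
    have : ((dep7 n (x + p) : ℕ) : ℤ) ≤ 7 := by exact_mod_cast d1le
    linarith

end Cell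

/-- **`casLB(b(n),p) ≥ −9`** for `10n < p ≤ 11n` (`VB ≥ −6`, rows `≥ −3`; the census value of the cell). -/
theorem casLB_ge1011 {n p : ℕ} (hp10 : 10 * n < p) (hp11 : p ≤ 11 * n) : -9 ≤ casLB (bRec n) p := by
  rcases casLB_ge_or_noPole (bRec n) p (-6) (-3)
      (fun x hx _ => (classExp_ge_neg6 hp10 hp11 hx).trans (classExp_le_classNu _ _ _)) (by norm_num)
      (fun x hx _ => by linarith [classExp_ge_neg6 hp10 hp11 hx]) (fun _ => by norm_num) with ⟨h0, -⟩ | h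
  · rw [h0]; norm_num
  · linarith

/-- **`v_p(Cas_j(b(n))) ≥ −9`** on `10n < p ≤ 11n` (THEOREM LB). -/
theorem cas_ge_neg9 (n j p : ℕ) (hn : 1 ≤ n) (hj1 : 1 ≤ j) (hj7 : j ≤ 7) (hprime : p.Prime) (hp10 : 10 * n < p) (hp11 : p ≤ 11 * n)
    (hwin : (41 * n + 2 : ℤ) < (p : ℤ) ^ 2) (hcas : casoratian (bRec n) j ≠ 0) :
    (-9 : ℤ) ≤ padicValRat p (casoratian (bRec n) j) := by
  have hb0 : (bRec n 0 + 2 : ℤ) < (p : ℤ) ^ 2 := by rw [bRec_zero]; exact_mod_cast hwin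
  have h := casoratianClassBound_holds (bRec n) j p (inPolytope_bRec n) hj1 hj7
    (inPolytope_shift_bRec n j hn hj1 hj7) hprime (by omega) hb0 hcas
  linarith [casLB_ge1011 hp10 hp11]

/-- **`N_p(b(n)) = 17`** for `10n < p ≤ 11n` (pair blocks `c·n`, `c = 11,…,18`, counted `2,3,3,3,2,2,1,1` times, each exactly once). -/
theorem pairFloors_bRec_1011 {n p : ℕ} (hp10 : 10 * n < p) (hp11 : p ≤ 11 * n) : pairFloors (bRec n) p = 17 := by
  have hp0 : (0 : ℤ) < p := by exact_mod_cast (show 0 < p by omega)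
  have hq0 : ∀ (a b : ℤ), 0 ≤ (n : ℤ) * 41 - (n : ℤ) * a - (n : ℤ) * b → (n : ℤ) * 41 - (n : ℤ) * a - (n : ℤ) * b < p →
      ((n : ℤ) * 41 - (n : ℤ) * a - (n : ℤ) * b) / (p : ℤ) = 0 := fun a b h0 h1 => Int.ediv_eq_zero_of_lt h0 h1
  have hq1 : ∀ (a b : ℤ), (p : ℤ) ≤ (n : ℤ) * 41 - (n : ℤ) * a - (n : ℤ) * b → (n : ℤ) * 41 - (n : ℤ) * a - (n : ℤ) * b < 2 * p →
      ((n : ℤ) * 41 - (n : ℤ) * a - (n : ℤ) * b) / (p : ℤ) = 1 := by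
    intro a b h1 h2
    rw [Int.ediv_eq_iff_of_pos hp0]; constructor <;> omega
  unfold pairFloors
  simp only [sum_range_succ, sum_range_zero, bRec]
  norm_num
  rw [hq0 17 16 (by omega) (by omega),
      hq0 17 15 (by omega) (by omega),
      hq0 17 14 (by omega) (by omega),
      hq0 16 15 (by omega) (by omega),
      hq1 17 13 (by omega) (by omega),
      hq1 16 14 (by omega) (by omega),
      hq1 17 12 (by omega) (by omega),
      hq1 17 11 (by omega) (by omega),
      hq1 16 13 (by omega) (by omega),
      hq1 16 12 (by omega) (by omega),
      hq1 16 11 (by omega) (by omega),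
      hq1 15 14 (by omega) (by omega),
      hq1 15 13 (by omega) (by omega),
      hq1 15 12 (by omega) (by omega),
      hq1 15 11 (by omega) (by omega),
      hq1 14 13 (by omega) (by omega),
      hq1 14 12 (by omega) (by omega),
      hq1 14 11 (by omega) (by omega),
      hq1 13 12 (by omega) (by omega),
      hq1 13 11 (by omega) (by omega),
      hq1 12 11 (by omega) (by omega)]
  norm_num

/-- **PATH on the record cell `10n < p ≤ 11n`**: `⌊d/p⌋ = 2`, `N_p = 17`, `C⋆ ≤ 11`, so the node's value is `≤ 2 − 17 + 6 = −9 ≤ casLB ≤ v_p(Cas₇)`. -/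
theorem pathAccounting_bRec_cell1011 (n p : ℕ) (hn : 1 ≤ n) (hprime : p.Prime) (hp10 : 10 * n < p) (hp11 : p ≤ 11 * n)
    (hwin : (41 * n + 2 : ℤ) < (p : ℤ) ^ 2) (hcas : casoratian (bRec n) 7 ≠ 0) :
    dOf (bRec n) / (p : ℤ) - pairFloors (bRec n) p
        - min (if 2 ≤ dOf (bRec n) / (p : ℤ) then (1 : ℤ) else 0) (5 - (cStar (bRec n) p : ℤ))
      ≤ padicValRat p (casoratian (bRec n) 7) := by
  have hv := cas_ge_neg9 n 7 p hn (by norm_num) (by norm_num) hprime hp10 hp11 hwin hcas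
  have hC : (cStar (bRec n) p : ℤ) ≤ 11 := by exact_mod_cast cStar_le_eleven (bRec n) p
  have hp0 : (0 : ℤ) < p := by exact_mod_cast hprime.pos
  have hfd : dOf (bRec n) / (p : ℤ) = 2 := by
    rw [dOf_bRec]
    apply le_antisymm
    · have : (25 * (n : ℤ)) / (p : ℤ) < 3 := by rw [Int.ediv_lt_iff_lt_mul hp0]; omega
      omega
    · rw [Int.le_ediv_iff_mul_le hp0]; omega
  rw [hfd, if_pos (le_refl _), pairFloors_bRec_1011 hp10 hp11]
  have hmin : -6 ≤ min (1 : ℤ) (5 - (cStar (bRec n) p : ℤ)) := le_min (by norm_num) (by linarith)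
  linarith

end Summit.KontsevichZagierPeriods.Zeta5Search.RecordRay1011
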